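import Summits.Langlands.Langlands.Theses.EisensteinGelfandKirillov
import Literature.NumberTheory.GaloisRepresentations.HeckeDeterminant
import Summits.Langlands.Langlands.Theorems.ReducibleOrdinaryProModular.Negative.LevelAndRamification

/-!
# Line `gk-additivity` — SEEDLESS CHAIN for `ProModularOfGKBound` (crux stmt-Langlands-18273,
# route `EisensteinGelfandKirillov`)

Crux (FIXED, route decl): `ProModularOfGKBound := EisensteinGKBound → Q`, `Q` = pro-modularity
(`∃ 𝒰 : TameLevel 2 F p, 𝒰.IsPadicallyAutomorphic ρ`) of every irreducible, totally odd,
a.e.-unramified, residually upper-triangular `p`-distinguished `ρ : Γ_F → GL₂(ℚ̄_p)`, `F` totally real,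
`p ≥ 5`, `p ∤ disc F`.  Standing facts (Disproof.lean `proModularOfGKBound_iff_proModularity_of_door`,
VERDICT-misstated.md, TRIAGE r1-1/2/3): the typed door `EisensteinGKBound` is TRUE by level collapse,
so any skeleton concluding the crux by name must prove `Q`; the INTENDED door (GK-dimension of the
Eisenstein torsion `≤ [F:ℚ]`, supported `T_v` + central `S_v` clause) is re-typed HERE in tame-level
form as `EisensteinGKBoundTame` and enters as `stub_door`.

## The line (idea card `Ideas/gk-additivity.md`, sharpened by the triage)

The fibre inequality `δ(M) ≤ dim A + δ(M/𝔪_A M)` (Pan 2022 Prop. 3.6.12 induction; the card's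
lever) turns the intended door into the RING-level bound `dim 𝕋^D_ψ(U^p)_𝔪 ≥ 1 + 2[F:ℚ]` at the
Eisenstein maximal ideal of the fixed-central-character completed Hecke algebra of a totally
definite quaternion algebra (`p ∤ disc F` ⇒ completed homology projective over `k⟦K₀/Z₀⟧`,
`δ = 3[F:ℚ]`).  Ring-level suffices for a SEED: a minimal prime `P₀` of maximal dimension gives a
pro-modular DOMAIN FAMILY `B₀ = 𝕋_𝔪/P₀` of Krull dimension `≥ 1 + 2[F:ℚ]`, whose coheight-one
characteristic-`p` primes avoiding the (≤ `[F:ℚ] + δ_F`-dimensional) reducible locus are NICE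
PRIMES in the sense of Pan 2022 Def. 4.1.4 — pro-modular by construction, with NO ordinary locus,
NO Hida theory, NO Skinner–Wiles seed and NO abelian hypothesis on `F` (`stub_seed`).  Pro-modularity
then PROPAGATES (Skinner–Wiles' connectedness mechanism, run in the full deformation space):
`stub_chain` links `ρ` to the seed through a chain of big domain families meeting in nice points
(Grothendieck/Brodmann–Rung connectedness dimension `c(R_b) ≥ 2[F:ℚ]` of the Borel deformation rings
`R_b ≅ 𝒪⟦x₁…x_{h¹}⟧/(f₁…f_{h²})`, `h¹ − h² = 2[F:ℚ]`), and `stub_propagate` is Pan 2022 Thm. 4.1.6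
("`R^{ps}_𝔮 → 𝕋_𝔮` has nilpotent kernel at a nice prime") in family language, WITHOUT `p` split:
the route's bet — the door's `𝔪 ⇝ 𝔮` semicontinuity (the same fibre inequality with base `k⟦T⟧`,
card item (b)) + Gee–Newton miracle flatness in place of Paškūnas' `GL₂(ℚ_p)` block theory.
`stub_twist` normalises `det ρ = ε · ψ₀`, `ψ₀` of finite order prime to `p` (families carry the
fixed-determinant numerology `1 + 2[F:ℚ]`; twisting `p`-adic automorphy by characters is standard).

All interface notions (`IsFamily`, `IsProModular`, `SpecializesTo`, `IsNicePoint`, `JunctionClosed`,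
`Linked`, `IsSeed`) are transparent `Prop`-definitions over EXISTING declarations only
(`GaloisDeterminant`, `ChenevierDeterminant.charpoly/ground/IsContinuous`, `TameLevel`,
`CompletedCohomologyHeckeAlgebraGLn`, `heckeT`, `heckeFrobPoly`, `IsPadicallyAutomorphic`,
`FramedRep.charpoly/IsAbsolutelyIrreducible`, `HasUpperTriangularIntegralModel`, `residualDiag`,
`GaloisRep.cyclotomicCharacter`, `ringKrullDim`, …); nothing is posited.

PROVED here (no `sorry`): `heckeFrobPoly_map`, `isPadicallyAutomorphic_of_specializesTo`
(a `ℚ̄_p`-specialisation of a pro-modular family that is a.e. unramified is `p`-adically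
automorphic — bad-set enlargement as in the landed
`ReducibleOrdinaryProModular.Negative.exists_isPadicallyAutomorphic_bad_eq`), and the composition
`ProModularOfGKBound_of : ProModularOfGKBound` (the five registered stubs applied by name; no
`sorry` of its own — the same script with the five STATEMENTS as hypotheses,
`EisensteinGKBoundTame → TwistReduction → SeedOfDoor → ChainLink → PropagationAtNicePoints →
ProModularOfGKBound`, was checked in the planner's folder with axioms `propext`, `Classical.choice`,
`Quot.sound` only; it is not kept here because the skeleton registry admits exactly one theorem
concluding the crux).

Disproof.lean honoured: no `_false_without_` theorem exists for this crux; the skeleton respects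
`proModularOfGKBound_iff_proModularity_of_door` (it proves `Q`, the typed door binder is idle and
the INTENDED door is an explicit stub), the §Pre-targets advisory on THIS card (ring → component:
answered — only the RING-level bound is consumed, by `stub_seed`; the component-level statement
needed at link primes is supplied by the Galois side, `IsBig` of the already-pro-modular family in
`JunctionClosed`), and types the Hecke side on the fixed-central-character quaternionic algebra, never
on the all-degree cohomological `𝕋(K^p)` (HeckeDimOfGKBound defect) — GL₂-side objects appear only
through `IsPadicallyAutomorphic`/`heckeT` points.  Landed Negative lemmas checked against:
`ReducibleOrdinaryProModular.Negative.*` (imported; `bad ⊇` ramification is built into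
`isPadicallyAutomorphic_of_specializesTo`).
-/

set_option linter.dupNamespace false

noncomputable section

namespace Summit.Langlands.Langlands.Cruxes.ProModularOfGKBound.GkAdditivity

open Summit.Langlands.Langlands.Theses.EisensteinGelfandKirillov
open scoped NumberField Polynomial
open Filter IsDedekindDomain Field IsLocalRing
open Literature.NumberTheory.GaloisRepresentations Literature.NumberTheory.Automorphic
open Literature.NumberTheory.Automorphic.BigHeckeGLn

/-! ## 0. The intended door, tame-level form -/

open scoped Classical in
/-- **`EisensteinGKBoundTame` — the INTENDED door (Gee–Newton codimension / Gelfand–Kirillov bound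
at an Eisenstein maximal ideal) in TAME-LEVEL form.**  Verbatim the route's typed door
`EisensteinGKBound` (same binders, same admissibility of `g` via the coordinate order and the
reduced-norm clause) with THREE changes, exactly those asked for by REVIEW-R2 / crux idea
`eisenstein-door-supported-hecke` (R⁺) and by TRIAGE r1-2/3 ("quantified over tame levels `U^p`"):
(1) the Hecke element `g` is SUPPORTED at `v` (`g_w = 1` for `w ≠ v`: classical `T_v`, no level
collapse); (2) the CENTRAL clause `N(v) · S_v fᵢ = c₁(v) c₂(v) · fᵢ` for the central element
supported at `v` with `v`-component a uniformiser (BHHMS normalisation `N(w) − S_w det ρ̄(Frob_w) ∈ 𝔪`,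
arXiv:2009.03127 §8.1; it pins the central character, so GK-dimension is measured on `K₁/Z₁`);
(3) an arbitrary TAME LEVEL `Up ≤ Ô^×`, open, hyperspecial at `w ∉ S` and above `p`, with
`U(r) = Up ∩ (1 + p^r Ô)`; the constant `C` may depend on everything before `r`.
CLAIM: `card ι ≤ C · p^(r[F:ℚ])` for every `k`-linearly independent family of `𝔪_Eis`-torsion forms
of level `U(r)`, i.e. GK-dim of `lim_r S(U(r),k)[𝔪_Eis] ≤ [F:ℚ]`.  Taking `Up = Ô^×` recovers R⁺.
[cite: BreuilEtAl2023, Thm 1.1 and §8.1] [cite: GeeNewton2020, §1 and §4.3] -/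
def EisensteinGKBoundTame : Prop :=
  ∀ (F : Type) [Field F] [NumberField F], NumberField.IsTotallyReal F →
  ∀ (p : ℕ) [Fact p.Prime], 5 ≤ p → ¬ ((p : ℤ) ∣ NumberField.discr F) →
  ∀ (a b : (NumberField.RingOfIntegers F)), a ≠ 0 → b ≠ 0 →
  let D := QuaternionAlgebra F (algebraMap _ F a) (0 : F) (algebraMap _ F b);
  Literature.NumberTheory.Automorphic.IsTotallyDefinite F D →
  (∀ v : IsDedekindDomain.HeightOneSpectrum (NumberField.RingOfIntegers F),
    (p : (NumberField.RingOfIntegers F)) ∈ v.asIdeal →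
      Literature.NumberTheory.Automorphic.IsSplitAt D v) →
  ∀ (k : Type) [Field k] [CharP k p] [TopologicalSpace k] [DiscreteTopology k]
    (S : Finset (IsDedekindDomain.HeightOneSpectrum (NumberField.RingOfIntegers F))),
  (∀ v : IsDedekindDomain.HeightOneSpectrum (NumberField.RingOfIntegers F),
    ((2 * p : ℕ) : (NumberField.RingOfIntegers F)) * a * b ∈ v.asIdeal → v ∈ S) →
  ∀ (χ₁ χ₂ : Literature.NumberTheory.GaloisRepresentations.FramedGaloisRep F k 1)
    (c₁ c₂ : IsDedekindDomain.HeightOneSpectrum (NumberField.RingOfIntegers F) → k),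
  (∀ v ∉ S, χ₁.IsUnramifiedAt v ∧ χ₂.IsUnramifiedAt v ∧
    χ₁.HasFrobCharpolyAt v (Polynomial.X - Polynomial.C (c₁ v)) ∧
    χ₂.HasFrobCharpolyAt v (Polynomial.X - Polynomial.C (c₂ v))) →
  (∀ v : IsDedekindDomain.HeightOneSpectrum (NumberField.RingOfIntegers F),
    (p : (NumberField.RingOfIntegers F)) ∈ v.asIdeal → ∃ σ, χ₁.toLocal v σ ≠ χ₂.toLocal v σ) →
  -- (3) the tame level `Up`: open, inside `Ô^×`, no condition at the places above `p`
  ∀ (Up : Subgroup (Literature.NumberTheory.Automorphic.finiteAdelicUnits F D)),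
  IsOpen (Up : Set (Literature.NumberTheory.Automorphic.finiteAdelicUnits F D)) →
  Up ≤ Literature.NumberTheory.Automorphic.QuaternionAlgebra.integralUnits a b →
  (∀ u ∈ Literature.NumberTheory.Automorphic.QuaternionAlgebra.integralUnits a b,
    (∀ w : IsDedekindDomain.HeightOneSpectrum (NumberField.RingOfIntegers F),
      (p : (NumberField.RingOfIntegers F)) ∉ w.asIdeal → ∀ j : Fin 4,
        (Literature.NumberTheory.Automorphic.QuaternionAlgebra.adelicCoords a b (↑u - 1) j) w = 0) →
    u ∈ Up) →
  -- … and `Up` is hyperspecial away from `S`: it contains the full local factor `Ô_w^×`, `w ∉ S`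
  (∀ w ∉ S, ∀ u ∈ Literature.NumberTheory.Automorphic.QuaternionAlgebra.integralUnits a b,
    (∀ w' : IsDedekindDomain.HeightOneSpectrum (NumberField.RingOfIntegers F), w' ≠ w →
      ∀ j : Fin 4,
        (Literature.NumberTheory.Automorphic.QuaternionAlgebra.adelicCoords a b (↑u - 1) j) w' = 0) →
    u ∈ Up) →
  ∀ (U : ℕ → Subgroup (Literature.NumberTheory.Automorphic.finiteAdelicUnits F D))
    [∀ r, IsHeckeTriple (⊤ : Submonoid (Literature.NumberTheory.Automorphic.finiteAdelicUnits F D))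
      (U r) (U r)],
  (∀ r u, u ∈ U r ↔ (u ∈ Up ∧ ∀ i : Fin 4,
    ∃ y ∈ Literature.NumberTheory.Automorphic.integralFiniteAdeles F,
      Literature.NumberTheory.Automorphic.QuaternionAlgebra.adelicCoords a b (↑u - 1) i =
        ↑(p ^ r) * y)) →
  ∃ C : ℝ, ∀ (r : ℕ) (ι : Type) [Fintype ι]
    (f : ι → Literature.NumberTheory.Automorphic.QuaternionicForm D (U r) k),
  LinearIndependent k f →
  (∀ i, ∀ v ∉ S,
    -- (1) supported Hecke elements at `v`: `T_v fᵢ = (c₁ v + c₂ v) fᵢ`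
    (∀ g : Literature.NumberTheory.Automorphic.finiteAdelicUnits F D,
      (let x := Literature.NumberTheory.Automorphic.QuaternionAlgebra.adelicCoords a b ↑g;
        Literature.NumberTheory.Automorphic.QuaternionAlgebra.adelicEquiv a b ↑g ∈
            Literature.NumberTheory.Automorphic.QuaternionAlgebra.adelicOrder a b ∧
        (let nrd : IsDedekindDomain.FiniteAdeleRing (NumberField.RingOfIntegers F) F :=
            x 0 ^ 2 - algebraMap _ _ a * x 1 ^ 2 - algebraMap _ _ b * x 2 ^ 2 +
              algebraMap _ _ a * algebraMap _ _ b * x 3 ^ 2;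
          ∀ w : IsDedekindDomain.HeightOneSpectrum (NumberField.RingOfIntegers F),
            Valued.v (nrd w) = if w = v then WithZero.exp (-1) else 1) ∧
        (∀ w : IsDedekindDomain.HeightOneSpectrum (NumberField.RingOfIntegers F), w ≠ v →
          ∀ j : Fin 4,
            (Literature.NumberTheory.Automorphic.QuaternionAlgebra.adelicCoords a b (↑g - 1) j) w
              = 0)) →
      Literature.NumberTheory.Automorphic.QuaternionicForm.heckeOperator k g (f i) =
        (c₁ v + c₂ v) • f i) ∧
    -- (2) the central element supported at `v` with `z_v` a uniformiser: `N(v) S_v fᵢ = c₁ c₂ fᵢ`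
    (∀ z : Literature.NumberTheory.Automorphic.finiteAdelicUnits F D,
      ((∀ j : Fin 4, j ≠ 0 →
          Literature.NumberTheory.Automorphic.QuaternionAlgebra.adelicCoords a b ↑z j = 0) ∧
        (∀ w : IsDedekindDomain.HeightOneSpectrum (NumberField.RingOfIntegers F), w ≠ v →
          (Literature.NumberTheory.Automorphic.QuaternionAlgebra.adelicCoords a b (↑z - 1) 0) w
            = 0) ∧
        Valued.v ((Literature.NumberTheory.Automorphic.QuaternionAlgebra.adelicCoords a b ↑z 0) v)
          = WithZero.exp (-1)) →
      (Ideal.absNorm v.asIdeal : k) •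
          Literature.NumberTheory.Automorphic.QuaternionicForm.heckeOperator k z (f i) =
        (c₁ v * c₂ v) • f i)) →
  (Fintype.card ι : ℝ) ≤ C * (p : ℝ) ^ (r * Module.finrank ℚ F)

/-! ## 1. Interface: sector, families, pro-modularity, specialisation, nice points, linkage -/

section Interface

variable (F : Type) [Field F] [NumberField F] (p : ℕ) [Fact p.Prime]

/-- The valuation ring `𝒪 = 𝒪_{ℚ̄_p}` of `ℚ̄_p = PadicAlgCl p` (the crux's `O`, pinned by its binder
`O = Valued.v.valuationSubring`). [folklore] -/
abbrev Obar : ValuationSubring (PadicAlgCl p) :=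
  (Valued.v : Valuation (PadicAlgCl p) NNReal).valuationSubring

/-- The residue field `𝔽̄_p` of `𝒪_{ℚ̄_p}` (home of the residual characters `χ̄ᵢ = residualDiag ρ₀ i`).
[folklore] -/
abbrev κbar : Type := ResidueField (Obar p)

/-- The crux's sector hypotheses on `(ρ, ρ₀)` bundled: irreducible, totally odd, a.e. unramified,
residually upper-triangular integral model `ρ₀`, `p`-distinguished at every `v ∣ p`
(verbatim the binders of `ProModularOfGKBound` after `O`). [folklore] -/
def InSector (O : ValuationSubring (PadicAlgCl p)) (ρ : FramedGaloisRep F (PadicAlgCl p) 2)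
    (ρ₀ : absoluteGaloisGroup F →* GL (Fin 2) O) : Prop :=
  ρ.toGaloisRep.IsIrreducible ∧ ρ.IsOdd ∧ (∀ᶠ v in cofinite, ρ.IsUnramifiedAt v) ∧
    ρ.HasUpperTriangularIntegralModel ρ₀ ∧
    ∀ v : HeightOneSpectrum (𝓞 F), ((p : ℕ) : 𝓞 F) ∈ v.asIdeal → IsPDistinguishedAt ρ₀ v

/-- **Normalised determinant**: `det ρ = ε · ψ₀` with `ψ₀ ^ N = 1`, stated as `(det ρ g)^N = ε(g)^N`
(`ε` = the tree's `p`-adic cyclotomic character `GaloisRep.cyclotomicCharacter F p`, pushed along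
`ℤ_p → ℚ̄_p`).  Pan 2022 §4.1.1 fixes the determinant `χ` of all pseudo-deformations; this is the
twist-normal form every `ρ` of the sector can be brought to (`TwistReduction`). [folklore] -/
def DetNormalized (N : ℕ) (ρ : FramedGaloisRep F (PadicAlgCl p) 2) : Prop :=
  ∀ g : absoluteGaloisGroup F,
    ((Matrix.GeneralLinearGroup.det (ρ g) : (PadicAlgCl p)ˣ) : PadicAlgCl p) ^ N =
      algebraMap ℤ_[p] (PadicAlgCl p) (((GaloisRep.cyclotomicCharacter F p g : ℤ_[p]ˣ) : ℤ_[p]) ^ N)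

/-- **A (domain) FAMILY of 2-dimensional Galois determinants** with coefficient ring `B` — the
objects of Pan's architecture: an irreducible component `Spec (R/P)` of a global (pseudo-)deformation
ring, or of a localised completed Hecke algebra `𝕋_𝔪/P₀`, with its universal determinant.
Conditions: `B` a compact Hausdorff Noetherian LOCAL DOMAIN whose maximal ideal is open (⇔ complete
local Noetherian with finite residue field, profinite topology), a topological `ℤ_p`-algebra;
`D` continuous, unramified outside `S` (charpoly sense), with NORMALISED determinant
`(det D)^N = ε^N` (fixed determinant up to the finite-order `ψ₀`, Pan 2022 §4.1.1).
[cite: Pan2022, §4.1.1 and Def 4.1.4] -/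
structure IsFamily (S : Set (HeightOneSpectrum (𝓞 F))) (N : ℕ) (B : Type) [CommRing B]
    [TopologicalSpace B] [Algebra ℤ_[p] B] (D : GaloisDeterminant F B 2) : Prop where
  isDomain : IsDomain B
  isNoetherianRing : IsNoetherianRing B
  isLocalRing : IsLocalRing B
  isOpen_maximalIdeal : IsOpen ((@IsLocalRing.maximalIdeal B _ isLocalRing : Ideal B) : Set B)
  isTopologicalRing : IsTopologicalRing B
  compactSpace : CompactSpace B
  t2Space : T2Space B
  continuous_algebraMap : Continuous (algebraMap ℤ_[p] B)
  isContinuous : D.IsContinuous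
  isUnramifiedAt : ∀ v ∉ S, D.IsUnramifiedAt v
  det_pow_eq : ∀ g : absoluteGaloisGroup F,
    D.ground (MonoidAlgebra.of B (absoluteGaloisGroup F) g) ^ N =
      algebraMap ℤ_[p] B (((GaloisRep.cyclotomicCharacter F p g : ℤ_[p]ˣ) : ℤ_[p]) ^ N)

/-- **Big** family: Krull dimension `≥ 1 + 2[F:ℚ]` — the fixed-determinant numerology
`dim 𝕋_𝔪 = 1 + dim B − l₀ = 1 + 2[F:ℚ]` (Gee–Newton) / `h¹ − h² = 2[F:ℚ]` (Pan 2022 Lemma 7.1.3).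
[cite: Pan2022, Lemma 7.1.3] [cite: GeeNewton2020, §1] -/
def IsBig (B : Type) [CommRing B] : Prop :=
  ((1 + 2 * Module.finrank ℚ F : ℕ) : WithBot ℕ∞) ≤ ringKrullDim B

/-- **Pro-modular family** (GL₂-side, the currency of the crux's conclusion): the determinant is
pulled back from a CONTINUOUS `B`-valued point `x` of a completed-cohomology Hecke algebra `𝕋(𝒰)`
of `GL₂/F` — `D(X − Frob_v) = X² − x(T_{v,1}) X + q_v x(T_{v,2})` for `v ∉ 𝒰.bad`
(`heckeFrobPoly`, arithmetic Frobenius).  Pan's "`𝔭` comes from a prime of `𝕋_𝔪`" for the family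
`R^{ps}/𝔭` (Pan 2022 §4.1.3), transported to `BigHeckeGLn`. [cite: Pan2022, §4.1.3] -/
def IsProModular (B : Type) [CommRing B] [TopologicalSpace B] (D : GaloisDeterminant F B 2) :
    Prop :=
  ∃ 𝒰 : TameLevel 2 F p, ∃ x : CompletedCohomologyHeckeAlgebraGLn 𝒰 →+* B, Continuous x ∧
    ∀ v ∉ 𝒰.bad, D.HasFrobCharpolyAt v
      (heckeFrobPoly 2 (Ideal.absNorm v.asIdeal) fun i => x (𝒰.heckeT v i))

/-- **Specialisation** of the family `(B, D)` to a framed representation `ρA` over `A`: a continuous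
ring map `y : B → A` carrying the characteristic polynomials of `D` to those of `ρA`
(`χ_{ρA}(g) = y(χ_D(g))` for all `g ∈ Γ_F`; by Amitsur/Chenevier the characteristic polynomials
determine the determinant).  Frame-independent. [cite: Chenevier2014Determinants, §1.3] -/
def SpecializesTo (B : Type) [CommRing B] [TopologicalSpace B] (D : GaloisDeterminant F B 2)
    (A : Type) [CommRing A] [TopologicalSpace A] (ρA : FramedGaloisRep F A 2) : Prop :=
  ∃ y : B →+* A, Continuous y ∧ ∀ g : absoluteGaloisGroup F,
    FramedRep.charpoly ρA g = ((D.charpoly (MonoidAlgebra.of B (absoluteGaloisGroup F) g)).map y)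

/-- **Nice point** of residual type `χ̄ = (χ̄₀, χ̄₁)` (Pan 2022 Def. 4.1.4, conditions (1)–(3); his
(4) dihedral clause and (5) constancy at `S ∖ Σ_p` are proof-specific and omitted): a representation
`ρL : Γ_F → GL₂(L)` over a NON-ARCHIMEDEAN LOCAL FIELD `L` OF CHARACTERISTIC `p` (locally compact,
Hausdorff, non-discrete topological field with `char L = p`, i.e. `L ≅ 𝔽_q((T))` — the normalisation
`A ≅ 𝔽⟦T⟧` of `𝕋_𝔪/𝔮`, `dim 𝕋_𝔪/𝔮 = 1`, `p ∈ 𝔮`), ABSOLUTELY IRREDUCIBLE, unramified outside `S`,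
admitting a lattice over the valuation ring `O_L` (compact open valuation subring) whose reduction
is a NON-SPLIT upper-triangular extension with diagonal characters `χ̄` up to order (`ι` embeds the
finite residue field of `O_L` into `𝔽̄_p`). [cite: Pan2022, Def 4.1.4] -/
def IsNicePoint (S : Set (HeightOneSpectrum (𝓞 F))) (χ : Fin 2 → absoluteGaloisGroup F → κbar p)
    (L : Type) [Field L] [TopologicalSpace L] (ρL : FramedGaloisRep F L 2) : Prop :=
  CharP L p ∧ IsTopologicalDivisionRing L ∧ LocallyCompactSpace L ∧ T2Space L ∧
    ¬ DiscreteTopology L ∧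
  FramedRep.IsAbsolutelyIrreducible ρL ∧ (∀ v ∉ S, ρL.IsUnramifiedAt v) ∧
  ∃ (OL : ValuationSubring L) (ρL₀ : absoluteGaloisGroup F →* GL (Fin 2) OL)
    (ι : ResidueField OL →+* κbar p) (τ : Equiv.Perm (Fin 2)),
    IsCompact (OL : Set L) ∧ IsOpen (OL : Set L) ∧
    ρL.HasUpperTriangularIntegralModel ρL₀ ∧
    (¬ ∃ c : ResidueField OL, ∀ g : absoluteGaloisGroup F,
        residue OL ((ρL₀ g).val 0 1) = c * (residualDiag ρL₀ 0 g - residualDiag ρL₀ 1 g)) ∧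
    ∀ (i : Fin 2) (g : absoluteGaloisGroup F), ι (residualDiag ρL₀ i g) = χ (τ i) g

/-- **Closure of a property `P` of families under NICE JUNCTIONS** — Pan 2022 Thm. 4.1.6 as a rule:
whenever two families `(B, D)`, `(B', D')` (type `(S, N)`) specialise to a COMMON nice point and
`B'` is BIG and has `P`, then `B` has `P`.  With `P = IsProModular` the bigness of the already
pro-modular `B'` is exactly Pan's difficulty (1) at the link prime (`dim 𝕋_𝔮 ≥ 2[F:ℚ]`), here
supplied by the Galois side / the seed instead of Paškūnas' Thm. 3.6.1. [cite: Pan2022, Thm 4.1.6] -/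
def JunctionClosed (S : Set (HeightOneSpectrum (𝓞 F))) (N : ℕ)
    (χ : Fin 2 → absoluteGaloisGroup F → κbar p)
    (P : ∀ (B : Type) [CommRing B] [TopologicalSpace B] [Algebra ℤ_[p] B],
      GaloisDeterminant F B 2 → Prop) : Prop :=
  ∀ (B : Type) [CommRing B] [TopologicalSpace B] [Algebra ℤ_[p] B] (D : GaloisDeterminant F B 2)
    (B' : Type) [CommRing B'] [TopologicalSpace B'] [Algebra ℤ_[p] B']
    (D' : GaloisDeterminant F B' 2)
    (L : Type) [Field L] [TopologicalSpace L] (ρL : FramedGaloisRep F L 2),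
    IsFamily F p S N B D → IsFamily F p S N B' D' → IsBig F B' →
    IsNicePoint F p S χ L ρL → SpecializesTo F B D L ρL → SpecializesTo F B' D' L ρL →
    P B' D' → P B D

/-- **`ρ` is LINKED to the seed family `(B₀, D₀)`**: every property of families that holds for the
seed and is closed under nice junctions holds for SOME family specialising to `ρ` — equivalently,
there is a finite chain of families `B₀, B₁, …, Bₙ ∋ ρ` with consecutive members meeting in nice
points (Skinner–Wiles' propagation "different irreducible components can be connected by nice
primes", Pan 2022 §5.4–5.5 and proof of Prop. 6.5.?, run in the FULL deformation space).
[cite: Pan2022, Para 5.4.5 and §5.5] [cite: SkinnerWiles1999, §6] -/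
def Linked (S : Set (HeightOneSpectrum (𝓞 F))) (N : ℕ) (χ : Fin 2 → absoluteGaloisGroup F → κbar p)
    (B₀ : Type) [CommRing B₀] [TopologicalSpace B₀] [Algebra ℤ_[p] B₀] (D₀ : GaloisDeterminant F B₀ 2)
    (ρ : FramedGaloisRep F (PadicAlgCl p) 2) : Prop :=
  ∀ P : (∀ (B : Type) [CommRing B] [TopologicalSpace B] [Algebra ℤ_[p] B],
      GaloisDeterminant F B 2 → Prop),
    P B₀ D₀ → JunctionClosed F p S N χ P →
    ∃ (B : Type) (_ : CommRing B) (_ : TopologicalSpace B) (_ : Algebra ℤ_[p] B)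
      (D : GaloisDeterminant F B 2),
      IsFamily F p S N B D ∧ P B D ∧ SpecializesTo F B D (PadicAlgCl p) ρ

/-- **Seed**: a BIG, PRO-MODULAR family of type `(S, N)` possessing a nice point of residual type
`χ̄` — what the door (via the fibre inequality) produces inside the Eisenstein completed Hecke
algebra of a totally definite quaternion algebra. [cite: Pan2022, Thm 3.6.1 and Def 4.1.4] -/
def IsSeed (S : Set (HeightOneSpectrum (𝓞 F))) (N : ℕ) (χ : Fin 2 → absoluteGaloisGroup F → κbar p)
    (B₀ : Type) [CommRing B₀] [TopologicalSpace B₀] [Algebra ℤ_[p] B₀]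
    (D₀ : GaloisDeterminant F B₀ 2) : Prop :=
  IsFamily F p S N B₀ D₀ ∧ IsBig F B₀ ∧ IsProModular F p B₀ D₀ ∧
    ∃ (L : Type) (_ : Field L) (_ : TopologicalSpace L) (ρL : FramedGaloisRep F L 2),
      IsNicePoint F p S χ L ρL ∧ SpecializesTo F B₀ D₀ L ρL

end Interface

/-! ## 2. The statements of the line (each is a registered stub below) -/

/-- **STUB 2 statement — twist normalisation.**  Every `ρ` of the sector has a TWIST `ρ'` in the
sector with normalised determinant `det ρ' = ε · ψ₀`, `ψ₀` of finite order `N` PRIME TO `p`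
(write `det ρ · ε⁻¹ = η² · ψ₀`: the pro-`p` part and the `p`-power finite part of a `p`-adic
character are squares since `p` is odd; `ρ' = ρ ⊗ η⁻¹`, `ρ₀' = ρ₀ ⊗ η⁻¹`; `η` is a.e. unramified),
and `p`-adic automorphy of `ρ'` gives that of `ρ = ρ' ⊗ η` (twisting completed-cohomology
eigensystems by `η ∘ det` level by level).  Stated existentially: no twist construction is named.
[cite: SkinnerWiles1999, §1] [cite: Pan2022, Para 7.1.2 ("we may always twist ρ")] -/
def TwistReduction : Prop :=
  ∀ (F : Type) [Field F] [NumberField F], NumberField.IsTotallyReal F →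
  ∀ (p : ℕ) [Fact p.Prime], 5 ≤ p → ¬ ((p : ℤ) ∣ NumberField.discr F) →
  ∀ (ρ : FramedGaloisRep F (PadicAlgCl p) 2) (ρ₀ : absoluteGaloisGroup F →* GL (Fin 2) (Obar p)),
  InSector F p (Obar p) ρ ρ₀ →
  ∃ (N : ℕ) (ρ' : FramedGaloisRep F (PadicAlgCl p) 2)
    (ρ₀' : absoluteGaloisGroup F →* GL (Fin 2) (Obar p)),
    0 < N ∧ N.Coprime p ∧ InSector F p (Obar p) ρ' ρ₀' ∧ DetNormalized F p N ρ' ∧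
    ((∃ 𝒰 : TameLevel 2 F p, 𝒰.IsPadicallyAutomorphic ρ') →
      ∃ 𝒰 : TameLevel 2 F p, 𝒰.IsPadicallyAutomorphic ρ)

/-- **STUB 3 statement — THE LEVER: the door seeds a big pro-modular family with a nice point.**
Granted the intended door `EisensteinGKBoundTame`: for every `ρ` of the (normalised) sector there
are a finite `S ⊇ {v ∣ p} ∪ Ram(ρ)` and a SEED of residual type `(χ̄₀, χ̄₁) = residualDiag ρ₀`.
Intended proof: choose a totally definite quaternion algebra `D/F` split above `p` (ramified at an
auxiliary place if `[F:ℚ]` is odd) and a tame level `U^p` (auxiliary places `N v ≡ 1 mod p` to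
create the Eisenstein congruence, Pan 2022 §4.1.1–4.1.2); the Eisenstein maximal ideal `𝔪` of the
fixed-central-character completed Hecke algebra `𝕋 = 𝕋^D_ψ(U^p)` carries a continuous Galois
determinant (Chenevier glueing of the `ρ_π`, JL + Taylor/Carayol); DOOR + the card's fibre
inequality `δ(M) ≤ dim(𝕋_𝔪/Ann) + δ(M/𝔪M)` with `δ(M) = 3[F:ℚ]` (`p ∤ disc F` ⇒ no `p`-torsion
stabilisers ⇒ `M` projective over `k⟦K₀/Z₀⟧`, Pan 2022 Lemmas 3.6.10–3.6.12) give
`dim 𝕋_𝔪 ≥ 1 + 2[F:ℚ]` at RING level; `B₀ := 𝕋_𝔪/P₀` for a minimal prime of maximal dimension is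
the family (`IsBig`), pro-modular GL₂-side via the continuous surjection `𝕋^{GL₂}(𝒰) ↠ 𝕋^D(U^p)`
(JL + universal coefficients, level by level); a coheight-one prime `𝔮 ∋ p` of `B₀` outside the
reducible locus (dimension `≤ [F:ℚ] + δ_F < 2[F:ℚ] ≤ dim B₀/p`; in a catenary local domain `(0)` is
the intersection of the coheight-one primes) with Ribet's lattice gives the nice point.
WHY IT MIGHT FAIL: the door itself (Mazur-type Eisenstein multiplicities), or `𝔪` not cuspidal at
any tame level for exotic `(χ̄₀, χ̄₁)` over non-abelian `F`. [cite: Pan2022, Prop 3.6.12 and Thm 3.6.1]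
[cite: GeeNewton2020, §4.3] -/
def SeedOfDoor : Prop :=
  EisensteinGKBoundTame →
  ∀ (F : Type) [Field F] [NumberField F], NumberField.IsTotallyReal F →
  ∀ (p : ℕ) [Fact p.Prime], 5 ≤ p → ¬ ((p : ℤ) ∣ NumberField.discr F) →
  ∀ (ρ : FramedGaloisRep F (PadicAlgCl p) 2) (ρ₀ : absoluteGaloisGroup F →* GL (Fin 2) (Obar p))
    (N : ℕ), InSector F p (Obar p) ρ ρ₀ → 0 < N → N.Coprime p → DetNormalized F p N ρ →
  ∃ S : Set (HeightOneSpectrum (𝓞 F)), S.Finite ∧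
    (∀ v : HeightOneSpectrum (𝓞 F), ((p : ℕ) : 𝓞 F) ∈ v.asIdeal → v ∈ S) ∧
    (∀ v ∉ S, ρ.IsUnramifiedAt v) ∧
    ∃ (B₀ : Type) (_ : CommRing B₀) (_ : TopologicalSpace B₀) (_ : Algebra ℤ_[p] B₀)
      (D₀ : GaloisDeterminant F B₀ 2),
      IsSeed F p S N (fun i => residualDiag ρ₀ i) B₀ D₀

/-- **STUB 4 statement — the chain (connectedness).**  A `ρ` of the normalised sector, unramified
outside the finite `S ∋ v ∣ p`, is LINKED (`Linked`) to every seed of its residual type.  Intended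
proof: `ρ` (after Ribet's choice of a non-split lattice, class `b`) and the seed's nice point
(class `b₀`) lie on the Borel deformation rings `R_b`, `R_{b₀}` (fixed determinant, unramified
outside `S`), presented as `𝒪⟦x₁…x_{h¹}⟧/(f₁…f_{h²})` with `h¹ − h² = 2[F:ℚ]` (global Euler
characteristic, `h⁰(ad⁰ ρ̄_b) = 0`), so every component is BIG and the connectedness dimension is
`≥ 2[F:ℚ]` (Grothendieck SGA2 XIII / Brodmann–Rung, Pan 2022 Para 5.4.5–5.4.7): consecutive
components meet in loci of dimension `≥ 2[F:ℚ]`, whose characteristic-`p` part (`≥ 2[F:ℚ] − 1`)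
exceeds the reducible locus (`≤ [F:ℚ] + δ_F`, `δ_F ≤ [F:ℚ] − 2`), hence contains NICE points
(coheight-one primes; all points of `R_b` are residually the non-split `b`); passing between the
classes `b₀`, `b` as in Pan 2022 §5.5.  WHY IT MIGHT FAIL: the margin is `1` and vanishes for
`F = ℚ`; Pan and Skinner–Wiles enlarge `[F:ℚ]` by soluble base change (Pan 2022 Para 7.1.2,
`|S ∖ Σ_p| + 1 < [F:ℚ]`), unavailable for PRO-modularity over the given `F`.
[cite: Pan2022, Para 5.4.5 and §5.5] [cite: SkinnerWiles1999, §6] -/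
def ChainLink : Prop :=
  ∀ (F : Type) [Field F] [NumberField F], NumberField.IsTotallyReal F →
  ∀ (p : ℕ) [Fact p.Prime], 5 ≤ p → ¬ ((p : ℤ) ∣ NumberField.discr F) →
  ∀ (ρ : FramedGaloisRep F (PadicAlgCl p) 2) (ρ₀ : absoluteGaloisGroup F →* GL (Fin 2) (Obar p))
    (N : ℕ), InSector F p (Obar p) ρ ρ₀ → 0 < N → N.Coprime p → DetNormalized F p N ρ →
  ∀ (S : Set (HeightOneSpectrum (𝓞 F))), S.Finite →
    (∀ v : HeightOneSpectrum (𝓞 F), ((p : ℕ) : 𝓞 F) ∈ v.asIdeal → v ∈ S) →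
    (∀ v ∉ S, ρ.IsUnramifiedAt v) →
  ∀ (B₀ : Type) [CommRing B₀] [TopologicalSpace B₀] [Algebra ℤ_[p] B₀] (D₀ : GaloisDeterminant F B₀ 2),
    IsSeed F p S N (fun i => residualDiag ρ₀ i) B₀ D₀ →
    Linked F p S N (fun i => residualDiag ρ₀ i) B₀ D₀ ρ

/-- **STUB 5 statement — propagation at nice points (`R_𝔮 = 𝕋_𝔮`, Pan 2022 Thm. 4.1.6 in family
form, WITHOUT `p` split).**  For `F` totally real, `p ≥ 5` unramified in `F`, a finite `S ∋ v ∣ p`,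
`N` prime to `p` and a `p`-DISTINGUISHED residual pair `χ̄`: pro-modularity of families is closed
under nice junctions — if `(B, D)` and `(B', D')` specialise to a common nice point and `B'` is big
and pro-modular, then `(B, D)` is pro-modular.  Intended proof = the route's thesis: Pan's patching of
completed homology of the definite quaternion algebra at the nice prime `𝔮` (§4), with Paškūnas'
`GL₂(ℚ_p)` block theory replaced by (i) the door's `𝔪 ⇝ 𝔮` semicontinuity
`δ_{k⟦T⟧⟦K₀⟧}(M/𝔮M) ≤ 1 + [F:ℚ]` (the card's item (b), same fibre inequality with base `k⟦T⟧`),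
(ii) Gee–Newton's non-commutative Cohen–Macaulayness and MIRACLE FLATNESS localised at `𝔮`
(GeeNewton2020 §4.3, App. A), (iii) Böckle–Iyengar–Paškūnas for the unrestricted local rings, and
difficulty (1) "`dim 𝕋_𝔮 ≥ 2[F:ℚ]`" read off `IsBig B'`; then `R^{ps} → B` factors through `𝕋_𝔪`
(nilpotent kernel at `𝔮`) and the point transfers to `BigHeckeGLn`.  WHY IT MIGHT FAIL (the crux's
own why-might-fail): miracle flatness is proved at a maximal ideal under Taylor–Wiles hypotheses;
its localisation at a one-dimensional prime and the GL₂ ↔ quaternionic transfer of big families may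
fail; barrier `PaskunasCentreFinitenessFails` forbids any Bernstein-centre finiteness for `f_v ≥ 2`.
[cite: Pan2022, Thm 4.1.6] [cite: GeeNewton2020, §4.3] [cite: arXiv:2512.21249, Thm 1.2.2] -/
def PropagationAtNicePoints : Prop :=
  ∀ (F : Type) [Field F] [NumberField F], NumberField.IsTotallyReal F →
  ∀ (p : ℕ) [Fact p.Prime], 5 ≤ p → ¬ ((p : ℤ) ∣ NumberField.discr F) →
  ∀ (S : Set (HeightOneSpectrum (𝓞 F))), S.Finite →
    (∀ v : HeightOneSpectrum (𝓞 F), ((p : ℕ) : 𝓞 F) ∈ v.asIdeal → v ∈ S) →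
  ∀ (N : ℕ), 0 < N → N.Coprime p →
  ∀ (χ : Fin 2 → absoluteGaloisGroup F → κbar p),
    (∀ v : HeightOneSpectrum (𝓞 F), ((p : ℕ) : 𝓞 F) ∈ v.asIdeal →
      ∃ σ : absoluteGaloisGroup (v.adicCompletion F),
        χ 0 (absGaloisRestrict F (v.adicCompletion F) σ) ≠
          χ 1 (absGaloisRestrict F (v.adicCompletion F) σ)) →
    JunctionClosed F p S N χ
      (fun (B : Type) [CommRing B] [TopologicalSpace B] [Algebra ℤ_[p] B]
        (D : GaloisDeterminant F B 2) => IsProModular F p B D)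

/-! ## 3. The registered stubs -/

/-- STUB 1 (L): the intended door, tame-level form. -/
theorem stub_door : EisensteinGKBoundTame := by
  sorry

/-- STUB 2 (M): twist normalisation of the determinant. -/
theorem stub_twist : TwistReduction := by
  sorry

/-- STUB 3 (L): door ⇒ seed (the gk-additivity lever; ring-level Hecke dimension ⇒ big pro-modular
family with a nice point). -/
theorem stub_seed : SeedOfDoor := by
  sorry

/-- STUB 4 (L): the connectedness chain in the Borel deformation rings. -/
theorem stub_chain : ChainLink := by
  sorry

/-- STUB 5 (XL, hardest): propagation of pro-modularity through nice points. -/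
theorem stub_propagate : PropagationAtNicePoints := by
  sorry

/-! ## 4. Proved glue -/

section Glue

variable {F : Type} [Field F] [NumberField F] {p : ℕ} [Fact p.Prime]

/-- `heckeFrobPoly` commutes with ring homomorphisms (it has integer-shaped coefficients). [folklore] -/
theorem heckeFrobPoly_map {R R' : Type*} [CommRing R] [CommRing R'] (f : R →+* R') (n q : ℕ)
    (a : ℕ → R) : (heckeFrobPoly n q a).map f = heckeFrobPoly n q (fun i => f (a i)) := by
  simp [heckeFrobPoly, Polynomial.map_sum]

/-- **A `ℚ̄_p`-specialisation of a pro-modular family which is unramified almost everywhere is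
`p`-adically automorphic.**  Compose the family's Hecke point with the specialisation, enlarge the
bad set by the (finite) ramification of `ρ` — `p`-adic automorphy is upward closed in `bad`, cf.
the landed `ReducibleOrdinaryProModular.Negative.exists_isPadicallyAutomorphic_bad_eq` — and transport
the Frobenius characteristic polynomials. [folklore] -/
theorem isPadicallyAutomorphic_of_specializesTo {B : Type} [CommRing B] [TopologicalSpace B]
    {D : GaloisDeterminant F B 2} {ρ : FramedGaloisRep F (PadicAlgCl p) 2}
    (hpm : IsProModular F p B D) (hsp : SpecializesTo F B D (PadicAlgCl p) ρ)
    (hur : ∀ᶠ v in cofinite, ρ.IsUnramifiedAt v) :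
    ∃ 𝒰 : TameLevel 2 F p, 𝒰.IsPadicallyAutomorphic ρ := by
  obtain ⟨𝒰, x, hx, hass⟩ := hpm
  obtain ⟨y, hy, hchar⟩ := hsp
  -- the enlarged bad set
  let T : Set (HeightOneSpectrum (𝓞 F)) := 𝒰.bad ∪ {v | ¬ ρ.IsUnramifiedAt v}
  have hT : T.Finite := 𝒰.bad_finite.union (by simpa [Filter.eventually_cofinite] using hur)
  have hle : 𝒰.bad ⊆ T := Set.subset_union_left
  let 𝒰' : TameLevel 2 F p :=
    { subgroup := 𝒰.subgroup
      bad := T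
      bad_finite := hT
      mem_bad_of_mem := fun v hv => hle (𝒰.mem_bad_of_mem v hv)
      isOpen := 𝒰.isOpen
      isCompact := 𝒰.isCompact
      le_glFiniteIntegralLevel := 𝒰.le_glFiniteIntegralLevel
      ofLocal_mem := fun v hv g hg => 𝒰.ofLocal_mem v (fun h => hv (hle h)) g hg
      mul_ofLocal_inv_mem := fun v hv u hu => 𝒰.mul_ofLocal_inv_mem v (fun h => hv (hle h)) u hu }
  -- fewer good places, fewer generators: `𝕋(𝒰') ≤ 𝕋(𝒰)` inside the common product ring
  have hgen : 𝒰'.heckeGenerators ⊆ 𝒰.heckeGenerators := by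
    rintro z (⟨v, hv, i, rfl⟩ | ⟨v, hv, rfl⟩)
    · exact Or.inl ⟨v, fun h => hv (hle h), i, rfl⟩
    · exact Or.inr ⟨v, fun h => hv (hle h), rfl⟩
  have hsub : 𝒰'.bigHeckeSubring ≤ 𝒰.bigHeckeSubring :=
    Subring.topologicalClosure_mono (Subring.closure_mono hgen)
  have hcont : Continuous (Subring.inclusion hsub) := by
    refine continuous_induced_rng.2 ?_
    have hval : Continuous (Subtype.val : 𝒰'.bigHeckeSubring → 𝒰'.bigEnd) :=
      continuous_subtype_val
    convert hval using 1
    funext z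
    exact Subring.coe_inclusion hsub z
  refine ⟨𝒰', (y.comp x).comp (Subring.inclusion hsub), hy.comp (hx.comp hcont), fun v hv => ?_⟩
  have hvb : v ∉ 𝒰.bad := fun h => hv (hle h)
  have hvur : ρ.IsUnramifiedAt v := by
    by_contra h
    exact hv (Or.inr h)
  refine ⟨hvur, ?_⟩
  have key : ∀ i, x (Subring.inclusion hsub (𝒰'.heckeT v i)) = x (𝒰.heckeT v i) := by
    intro i
    congr 1
    apply Subtype.ext
    rw [Subring.coe_inclusion, 𝒰'.coe_heckeT hv i, 𝒰.coe_heckeT hvb i]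
    rfl
  -- transport of the Frobenius characteristic polynomial along `y`
  intro 𝔓 h𝔓 σ hσ
  rw [hchar σ, hass v hvb 𝔓 h𝔓 σ hσ, heckeFrobPoly_map]
  congr 1
  funext i
  exact congrArg y (key i).symm

end Glue

/-! ## 5. The composition (kernel-checked, no `sorry` of its own) -/

/-- **Composition — the skeleton.**  The five REGISTERED STUBS, applied by name, give the crux BY
NAME.  Pure logic: discard the (idle) typed-door binder, pin `O`, twist to normalised determinant
(`stub_twist`), take the seed the door produces (`stub_seed stub_door`), link `ρ'` to it
(`stub_chain`), run `Linked` with `P := IsProModular` — closed under nice junctions by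
`stub_propagate`, `p`-distinguishedness of `χ̄ = residualDiag ρ₀'` read off the sector — and
specialise (`isPadicallyAutomorphic_of_specializesTo`, proved above).  This declaration contains no
`sorry` of its own; its only non-standard axiom is the stubs' `sorryAx` (the same script with the
five statements as hypotheses elaborates with axioms `propext`, `Classical.choice`, `Quot.sound`
only — checked in the planner's folder, `glue-statements.lean`). -/
theorem ProModularOfGKBound_of : ProModularOfGKBound := by
  have hdoor : EisensteinGKBoundTame := stub_door
  have htwist : TwistReduction := stub_twist
  have hseed : SeedOfDoor := stub_seed
  have hchain : ChainLink := stub_chain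
  have hprop : PropagationAtNicePoints := stub_propagate
  intro _hTypedDoor F _ _ hF p _ hp hdisc O hO ρ ρ₀ hirr hodd hur hup hdist
  subst hO
  obtain ⟨N, ρ', ρ₀', hN, hNp, hsec, hdet, htransfer⟩ :=
    htwist F hF p hp hdisc ρ ρ₀ ⟨hirr, hodd, hur, hup, hdist⟩
  apply htransfer
  obtain ⟨S, hSfin, hSp, hSur, B₀, _, _, _, D₀, hseed₀⟩ :=
    hseed hdoor F hF p hp hdisc ρ' ρ₀' N hsec hN hNp hdet
  have hlinked : Linked F p S N (fun i => residualDiag ρ₀' i) B₀ D₀ ρ' :=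
    hchain F hF p hp hdisc ρ' ρ₀' N hsec hN hNp hdet S hSfin hSp hSur B₀ D₀ hseed₀
  have hχ : ∀ v : HeightOneSpectrum (𝓞 F), ((p : ℕ) : 𝓞 F) ∈ v.asIdeal →
      ∃ σ : absoluteGaloisGroup (v.adicCompletion F),
        residualDiag ρ₀' 0 (absGaloisRestrict F (v.adicCompletion F) σ) ≠
          residualDiag ρ₀' 1 (absGaloisRestrict F (v.adicCompletion F) σ) :=
    fun v hv => hsec.2.2.2.2 v hv
  have hJ := hprop F hF p hp hdisc S hSfin hSp N hN hNp (fun i => residualDiag ρ₀' i) hχ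
  obtain ⟨B, _, _, _, D, _hfam, hpm, hspec⟩ :=
    hlinked (fun (B : Type) [CommRing B] [TopologicalSpace B] [Algebra ℤ_[p] B]
      (D : GaloisDeterminant F B 2) => IsProModular F p B D) hseed₀.2.2.1 hJ
  exact isPadicallyAutomorphic_of_specializesTo hpm hspec hsec.2.2.1

end Summit.Langlands.Langlands.Cruxes.ProModularOfGKBound.GkAdditivity
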